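import Summits.RiemannHypothesis.RiemannHypothesis.Theorems.EtaLeadingQuarterWeakLockingLayerConstruction

/-!
# Route EtaTailTrialBound — definitions: the re-locked Gaussian log-scale layer
(item `LockingLayer`, stmt-RiemannHypothesis-21599 — RH-free)

The witness layer for `EtaTailTrialBound.LockingLayer`: the explicit Gaussian log-scale profile `g_M`
and mass `D_M` of `EtaLeadingQuarterWeakLockingLayerConstruction.lean` (width `s_M² = (log M)/150`,
centre `(9/10) log M`), re-locked to the HALVED-ending constant of route EtaTailTrialBound
`L'_M = 1 − ∑_{m=2}^{M} (m = M ? 1/2 : 1)·(−1)^m m^{−1/2}`: amplitude `A'_M = L'_M/D_M`, layer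
`e'_M(m) = A'_M g_M(m)`. The algebra, the estimates and the route decl are proved in
`EtaTailTrialBoundLockingLayer.lean`. Nothing here bears on the truth of RH.
-/

noncomputable section

set_option linter.dupNamespace false  -- the mandated namespace repeats `RiemannHypothesis`

namespace Summit.RiemannHypothesis.RiemannHypothesis.Theorems.EtaTailTrialBound.Locking

open Summit.RiemannHypothesis.RiemannHypothesis.Theorems.EtaLeadingQuarter.Locking

/-- The halved-ending locking constant
`L'_M = 1 − ∑_{m=2}^{M} (m = M ? 1/2 : 1)·(−1)^m m^{−1/2}` (verbatim from the route decl
`EtaTailTrialBound.LockingLayer`). [folklore] -/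
def lockConstH (M : ℕ) : ℝ :=
  1 - ∑ m ∈ Finset.Icc 2 M, (if m = M then (1 / 2 : ℝ) else 1) * (-1 : ℝ) ^ m * (m : ℝ) ^ (-(1 / 2 : ℝ))

/-- The amplitude `A'_M = L'_M / D_M`. [folklore] -/
def ampH (M : ℕ) : ℝ := lockConstH M / mass M

/-- The layer `e'_M(m) = A'_M g_M(m)` (same Gaussian profile `g_M` and mass `D_M` as the weak twin
`EtaLeadingQuarter.Locking.layer`, different locking constant). [folklore] -/
def layerH (M m : ℕ) : ℝ := ampH M * bump M m

end Summit.RiemannHypothesis.RiemannHypothesis.Theorems.EtaTailTrialBound.Locking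

end
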